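import Summits.QuantumFields.YangMills.Theorems.SwapVirialDeficitSwapRingDeficitDefs
import Summits.QuantumFields.YangMills.Theorems.SwapVirialDeficitRingTraceSmooth
import Summits.QuantumFields.YangMills.Theorems.VirialFluxGapRingTreeGaugeSeam
import Summits.QuantumFields.YangMills.Theorems.VirialFluxGapTreeGaugeGibbsTransfer
import Summits.QuantumFields.YangMills.Theorems.FemtoTransferGapAxisPermutation
import HarnessLib

/-!
# Route `SwapVirialDeficit` (YangMills): the σ-GLUED ACTION DEFICIT — trace identity, sums form, invariance under the re-indexed seam action,
# and the tree-gauge transfer (bricks (α2-ii) of LEAD ym-line-sfw-p2 g93's fixed-`L` floor ∕ ceiling programme for `TT.twistTrace L β (2L)`;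
# free-hands support of item stmt-QuantumFields-24197 `SwapVirialDeficit.SwapGluedStiffness`)

With `F^S_z = swapRingDeficit L z` (✓`SwapVirialDeficitSwapRingDeficitDefs`), the σ-twin of the periodic deficit `F_z = RingDeficit.ringDeficit L z`:

* §1 `twistTrace_eq_sum_exp_mul_integral_deficit` — `TT.twistTrace L b (2L) = (1/8) Σ_z e^{12bL⁴} ∫ e^{−bF^S_z} dμ_L` (✓`twistTraceSucc_eq_sum_integral_prod`,
  ✓`swapSeamChain_eq_exp`); ★ `exp_mul_integral_deficit_le_twistTrace` — `(1/8) e^{12bL⁴} ∫ e^{−bF^S_0} dμ_L ≤ TT.twistTrace L b (2L)`;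
  `swapRingExponent_le` (`Ψ^S ≤ 12L⁴`), `swapRingDeficit_nonneg`, measurability;
* §2 ★ `swapRingDeficit_eq_sums` — `F^S_z = Σ D_i + D^S_seam + Σ ½(S_i + S_{i+1}) + ½(S_last + S(g·tw_z σU_0))`;
* §3 ★ `swapRingExponent_seamGaugeAct` ∕ `swapRingDeficit_seamGaugeAct` — invariance under `(U⃗, g) ↦ (h·U⃗, h·g·(h∘κ)⁻¹)`, `κ = sitePerm (swap 0 1)`
  (✓`configPerm_gaugeTransform`: `σ(h·U) = (h∘κ)·σU`); ★ `measureReal_swapDeficit_le_eq_fix`, ★ `integral_exp_swapDeficit_eq_fix` — the tree-gauge transfers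
  to `X_fix = SU(2)^{off} × (slices 1…2L−1) × (seam)` through ✓`measureReal_le_eq_fix_seam` ∕ ✓`integral_ringMeasure_eq_integral_fix_seam`.

HONEST FRAMING: bookkeeping for the σ-glued ring at fixed `L`; no floor or ceiling yet; ⟨24197⟩, ⟨24194⟩ and every rung stay OPEN; the Yang–Mills mass
gap is NOT proved; no summit is proved by a line.  THEOREMS ONLY (0 `def`, 0 `sorry`), standard axioms.  Width seat ym-line-sfw-p2-w3 g61 (cell ym-idea-1,
free hands), `--supports stmt-QuantumFields-24197`.  References: [cite: tHooft1979]; [cite: MontvayMunster1994, (3.145)]; [cite: Luscher1983, §2]; [cite: SeilerLNP1982, §2].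
-/

set_option autoImplicit false

noncomputable section

open MeasureTheory
open scoped BigOperators
open Literature.MathematicalPhysics.QuantumFieldTheory hiding SU2
open Literature.MathematicalPhysics.QuantumLattice

namespace Summit.QuantumFields.YangMills.Theorems.SwapVirialDeficit.SwapRing

open Summit.QuantumFields.YangMills.Theorems.FemtoTransferGap
open Summit.QuantumFields.YangMills.Theorems.FemtoTransferGap.TT
open Summit.QuantumFields.YangMills.Theorems.FemtoTransferGap.TT.SectorSmooth
open Summit.QuantumFields.YangMills.Theorems.VirialFluxGap.RingDeficit

variable {L : ℕ} [NeZero L]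

/-! ## §1 The σ-glued trace through the σ-glued deficit -/

/-- `Ψ^S_z` unfolded (definitional). [folklore] -/
theorem swapRingExponent_eq (z : Fin 3 → Bool) (p : (Fin (2 * L - 1 + 1) → GaugeConfig 3 L SU2) × (Site 3 L → SU2)) :
    swapRingExponent L z p = Real.log ((∏ i : Fin (2 * L - 1), transferKernel su2Rep 1 (p.1 i.castSucc) (p.1 i.succ)) *
      transferKernel su2Rep 1 (p.1 (Fin.last (2 * L - 1)))
        (gaugeTransform p.2 (twist3 z (configPerm (Equiv.swap (0 : Fin 3) 1) (p.1 0))))) := rfl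

/-- The σ-glued exponent is measurable. [folklore] -/
theorem measurable_swapRingExponent (z : Fin 3 → Bool) : Measurable (swapRingExponent L z) :=
  (measurable_swapSeamChain (L := L) 1 (2 * L - 1) z).log

/-- The σ-glued deficit is measurable. [folklore] -/
theorem measurable_swapRingDeficit (z : Fin 3 → Bool) : Measurable (swapRingDeficit L z) :=
  measurable_const.sub (measurable_swapRingExponent z)

/-- `Ψ^S_z ≤ 12L⁴`: `2L` bonds, each `log K_1 ≤ 6L³`. [cite: Luscher1983, §2] -/
theorem swapRingExponent_le (z : Fin 3 → Bool) (p : (Fin (2 * L - 1 + 1) → GaugeConfig 3 L SU2) × (Site 3 L → SU2)) :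
    swapRingExponent L z p ≤ 12 * (L : ℝ) ^ 4 := by
  rw [swapRingExponent_eq, log_swapSeamChain_one]
  have hL1 : 1 ≤ L := NeZero.one_le
  have hN : (((2 * L - 1 : ℕ) : ℝ) + 1) = 2 * (L : ℝ) := by
    rw [Nat.cast_sub (by omega), Nat.cast_mul]; push_cast; ring
  have hsum : ∑ i : Fin (2 * L - 1), Real.log (transferKernel su2Rep 1 (p.1 i.castSucc) (p.1 i.succ)) ≤
      ∑ _i : Fin (2 * L - 1), 6 * (L : ℝ) ^ 3 := Finset.sum_le_sum fun i _ => log_transferKernel_one_le _ _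
  rw [Finset.sum_const, Finset.card_univ, Fintype.card_fin, nsmul_eq_mul] at hsum
  have hseam := log_transferKernel_one_le (p.1 (Fin.last (2 * L - 1)))
    (gaugeTransform p.2 (twist3 z (configPerm (Equiv.swap (0 : Fin 3) 1) (p.1 0))))
  have h12 : 12 * (L : ℝ) ^ 4 = (((2 * L - 1 : ℕ) : ℝ) + 1) * (6 * (L : ℝ) ^ 3) := by rw [hN]; ring
  rw [h12]
  linarith

/-- ★ The σ-glued deficit is non-negative. [cite: Luscher1983, §2] -/
theorem swapRingDeficit_nonneg (z : Fin 3 → Bool) (p : (Fin (2 * L - 1 + 1) → GaugeConfig 3 L SU2) × (Site 3 L → SU2)) :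
    0 ≤ swapRingDeficit L z p := by
  unfold swapRingDeficit
  linarith [swapRingExponent_le (L := L) z p]

/-- ★ **Deficit form of the σ-glued trace**: `TT.twistTrace L b (2L) = (1/8) Σ_z e^{12bL⁴} ∫ e^{−b F^S_z} dμ_L`. [cite: tHooft1979]
[cite: MontvayMunster1994, (3.145)] -/
theorem twistTrace_eq_sum_exp_mul_integral_deficit (b : ℝ) :
    TT.twistTrace L b (2 * L) = (1 / 8 : ℝ) * ∑ z : Fin 3 → Bool,
      Real.exp (12 * b * (L : ℝ) ^ 4) * ∫ p, Real.exp (-(b * swapRingDeficit L z p)) ∂(ringMeasure L) := by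
  have hT : TT.twistTrace L b (2 * L) = twistTraceSucc L b (2 * L - 1) := rfl
  rw [hT, twistTraceSucc_eq_sum_integral_prod]
  congr 1
  refine Finset.sum_congr rfl fun z _ => ?_
  rw [← integral_const_mul]
  refine integral_congr_ae (ae_of_all _ fun p => ?_)
  show (∏ i : Fin (2 * L - 1), transferKernel su2Rep b (p.1 i.castSucc) (p.1 i.succ)) *
      transferKernel su2Rep b (p.1 (Fin.last (2 * L - 1)))
        (gaugeTransform p.2 (twist3 z (configPerm (Equiv.swap (0 : Fin 3) 1) (p.1 0)))) =
    Real.exp (12 * b * (L : ℝ) ^ 4) * Real.exp (-(b * swapRingDeficit L z p))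
  rw [swapSeamChain_eq_exp b (2 * L - 1) z p, ← Real.exp_add]
  congr 1
  unfold swapRingDeficit swapRingExponent
  ring

/-- ★ **The zero-flux sector bounds the σ-glued trace from below**: `(1/8)·e^{12bL⁴}·∫ e^{−b F^S_0} dμ_L ≤ TT.twistTrace L b (2L)`
(the seven other sector terms are `≥ 0`). [cite: tHooft1979] -/
theorem exp_mul_integral_deficit_le_twistTrace (b : ℝ) :
    (1 / 8 : ℝ) * (Real.exp (12 * b * (L : ℝ) ^ 4) * ∫ p, Real.exp (-(b * swapRingDeficit L (fun _ => false) p)) ∂(ringMeasure L)) ≤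
      TT.twistTrace L b (2 * L) := by
  rw [twistTrace_eq_sum_exp_mul_integral_deficit]
  refine mul_le_mul_of_nonneg_left ?_ (by norm_num)
  exact Finset.single_le_sum (f := fun z : Fin 3 → Bool =>
      Real.exp (12 * b * (L : ℝ) ^ 4) * ∫ p, Real.exp (-(b * swapRingDeficit L z p)) ∂(ringMeasure L))
    (fun z _ => mul_nonneg (Real.exp_pos _).le (integral_nonneg fun p => (Real.exp_pos _).le)) (Finset.mem_univ _)

/-! ## §2 The σ-glued deficit as a sum of non-negative bond and plaquette terms -/

/-- ★ **Sums form**: `F^S_z(P) = Σ_{i<2L−1} D_i + D^S_seam + Σ_{i<2L−1} ½(S_i + S_{i+1}) + ½(S_last + S(g·tw_z σP₀))`, `D = 6L³ − timeCoupling`,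
`D^S_seam = 6L³ − timeCoupling(P_last, g·tw_z σP₀)` (✓`ringDeficit_eq_sums` with the σ-glued seam). [cite: Luscher1983, §2] -/
theorem swapRingDeficit_eq_sums (z : Fin 3 → Bool) (P : (Fin (2 * L - 1 + 1) → GaugeConfig 3 L SU2) × (Site 3 L → SU2)) :
    swapRingDeficit L z P =
      (∑ i : Fin (2 * L - 1), (6 * (L : ℝ) ^ 3 - timeCoupling su2Rep (P.1 i.castSucc) (P.1 i.succ))) +
      (6 * (L : ℝ) ^ 3 - timeCoupling su2Rep (P.1 (Fin.last (2 * L - 1)))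
        (gaugeTransform P.2 (twist3 z (configPerm (Equiv.swap (0 : Fin 3) 1) (P.1 0))))) +
      (∑ i : Fin (2 * L - 1), (1 / 2 : ℝ) * (wilsonAction su2Rep (P.1 i.castSucc) + wilsonAction su2Rep (P.1 i.succ))) +
      (1 / 2 : ℝ) * (wilsonAction su2Rep (P.1 (Fin.last (2 * L - 1))) +
        wilsonAction su2Rep (gaugeTransform P.2 (twist3 z (configPerm (Equiv.swap (0 : Fin 3) 1) (P.1 0))))) := by
  unfold swapRingDeficit
  rw [swapRingExponent_eq, log_swapSeamChain_one, log_transferKernel_one]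
  rw [Finset.sum_congr rfl (fun i _ => log_transferKernel_one (P.1 (Fin.castSucc i)) (P.1 (Fin.succ i)))]
  have hL1 : 1 ≤ L := NeZero.one_le
  have hN : (((2 * L - 1 : ℕ) : ℝ) + 1) = 2 * (L : ℝ) := by
    rw [Nat.cast_sub (by omega), Nat.cast_mul]; push_cast; ring
  have h12 : 12 * (L : ℝ) ^ 4 = (∑ _i : Fin (2 * L - 1), 6 * (L : ℝ) ^ 3) + 6 * (L : ℝ) ^ 3 := by
    rw [Finset.sum_const, Finset.card_univ, Fintype.card_fin, nsmul_eq_mul]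
    have : 12 * (L : ℝ) ^ 4 = (((2 * L - 1 : ℕ) : ℝ) + 1) * (6 * (L : ℝ) ^ 3) := by rw [hN]; ring
    rw [this]; ring
  have key : (∑ i : Fin (2 * L - 1), (6 * (L : ℝ) ^ 3 - timeCoupling su2Rep (P.1 i.castSucc) (P.1 i.succ))) +
      (∑ i : Fin (2 * L - 1), (1 / 2 : ℝ) * (wilsonAction su2Rep (P.1 i.castSucc) + wilsonAction su2Rep (P.1 i.succ))) =
      (∑ _i : Fin (2 * L - 1), 6 * (L : ℝ) ^ 3) -
        ∑ i : Fin (2 * L - 1), (timeCoupling su2Rep (P.1 i.castSucc) (P.1 i.succ) -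
          (1 / 2 : ℝ) * (wilsonAction su2Rep (P.1 i.castSucc) + wilsonAction su2Rep (P.1 i.succ))) := by
    rw [← Finset.sum_add_distrib, ← Finset.sum_sub_distrib]
    exact Finset.sum_congr rfl fun i _ => by ring
  rw [h12]
  linarith [key]

/-! ## §3 Invariance under the re-indexed seam action and the tree-gauge transfer -/

/-- **The σ-glued exponent is invariant under `(U⃗, g) ↦ (h·U⃗, h·g·(h∘κ)⁻¹)`, `κ = sitePerm (swap 0 1)`**: the bond kernels are gauge
invariant (✓`transferKernel_gaugeTransform`), and on the seam `σ(h·U_0) = (h∘κ)·σU_0` (✓`configPerm_gaugeTransform`), so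
`(h g (h∘κ)⁻¹)·tw_z σ(h·U_0) = h·(g·tw_z σU_0)` (twists commute with gauge transformations). [cite: tHooft1979] [cite: Luscher1983, §2] -/
theorem swapRingExponent_seamGaugeAct (z : Fin 3 → Bool) (h : Site 3 L → SU2)
    (p : (Fin (2 * L - 1 + 1) → GaugeConfig 3 L SU2) × (Site 3 L → SU2)) :
    swapRingExponent L z ((fun i => gaugeTransform h (p.1 i), h * p.2 * (h ∘ ⇑(sitePerm (L := L) (Equiv.swap (0 : Fin 3) 1)))⁻¹) :
        (Fin (2 * L - 1 + 1) → GaugeConfig 3 L SU2) × (Site 3 L → SU2)) = swapRingExponent L z p := by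
  rw [swapRingExponent_eq, swapRingExponent_eq]
  congr 1
  congr 1
  · exact Finset.prod_congr rfl fun i _ => transferKernel_gaugeTransform su2Rep 1 h _ _
  · simp only
    have hperm : configPerm (Equiv.swap (0 : Fin 3) 1) (gaugeTransform h (p.1 0)) =
        gaugeTransform (h ∘ ⇑(sitePerm (L := L) (Equiv.swap (0 : Fin 3) 1))) (configPerm (Equiv.swap (0 : Fin 3) 1) (p.1 0)) := by
      rw [configPerm_gaugeTransform]
      rfl
    have hseam : gaugeTransform (h * p.2 * (h ∘ ⇑(sitePerm (L := L) (Equiv.swap (0 : Fin 3) 1)))⁻¹)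
        (twist3 z (configPerm (Equiv.swap (0 : Fin 3) 1) (gaugeTransform h (p.1 0)))) =
        gaugeTransform h (gaugeTransform p.2 (twist3 z (configPerm (Equiv.swap (0 : Fin 3) 1) (p.1 0)))) := by
      rw [hperm, ← gaugeTransform_twist3, gaugeTransform_gaugeTransform, gaugeTransform_gaugeTransform]
      congr 1
      funext x
      simp [mul_assoc]
    rw [hseam, transferKernel_gaugeTransform]

/-- Invariance of the σ-glued deficit. [folklore] -/
theorem swapRingDeficit_seamGaugeAct (z : Fin 3 → Bool) (h : Site 3 L → SU2)
    (p : (Fin (2 * L - 1 + 1) → GaugeConfig 3 L SU2) × (Site 3 L → SU2)) :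
    swapRingDeficit L z ((fun i => gaugeTransform h (p.1 i), h * p.2 * (h ∘ ⇑(sitePerm (L := L) (Equiv.swap (0 : Fin 3) 1)))⁻¹) :
        (Fin (2 * L - 1 + 1) → GaugeConfig 3 L SU2) × (Site 3 L → SU2)) = swapRingDeficit L z p := by
  unfold swapRingDeficit
  rw [swapRingExponent_seamGaugeAct]

/-- ★ **Tree-gauge transfer of the σ-glued sublevel volumes**: `μ_L{F^S_z ≤ s} = μ_fix{F^S_z(glue w ∷ r, g) ≤ s}` on
`X_fix = SU(2)^{off} × (slices 1…2L−1) × (seam)` (✓`measureReal_le_eq_fix_seam` with `κ = sitePerm (swap 0 1)`). [cite: SeilerLNP1982, §2] -/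
theorem measureReal_swapDeficit_le_eq_fix (z : Fin 3 → Bool) (s : ℝ) :
    (ringMeasure L).real {p | swapRingDeficit L z p ≤ s} =
      ((Measure.pi fun _ : OffIdx L => haarProbability SU2).prod
          ((Measure.pi fun _ : Fin (2 * L - 1) => configMeasure SU2 L).prod (gaugeMeasure L))).real
        {x | swapRingDeficit L z ((Fin.cons (glue x.1) x.2.1 : Fin (2 * L - 1 + 1) → GaugeConfig 3 L SU2), x.2.2) ≤ s} :=
  measureReal_le_eq_fix_seam (⇑(sitePerm (L := L) (Equiv.swap (0 : Fin 3) 1))) (measurable_swapRingDeficit z)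
    (fun h p => swapRingDeficit_seamGaugeAct z h p) s

/-- ★ **Tree-gauge transfer of the σ-glued Laplace integral** (`b ≥ 0`). [cite: SeilerLNP1982, §2] -/
theorem integral_exp_swapDeficit_eq_fix (z : Fin 3 → Bool) {b : ℝ} (hb : 0 ≤ b) :
    ∫ p, Real.exp (-(b * swapRingDeficit L z p)) ∂(ringMeasure L) =
      ∫ x, Real.exp (-(b * swapRingDeficit L z
          ((Fin.cons (glue x.1) x.2.1 : Fin (2 * L - 1 + 1) → GaugeConfig 3 L SU2), x.2.2)))
        ∂((Measure.pi fun _ : OffIdx L => haarProbability SU2).prod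
          ((Measure.pi fun _ : Fin (2 * L - 1) => configMeasure SU2 L).prod (gaugeMeasure L))) := by
  refine integral_ringMeasure_eq_integral_fix_seam (⇑(sitePerm (L := L) (Equiv.swap (0 : Fin 3) 1)))
    (G := fun p => Real.exp (-(b * swapRingDeficit L z p)))
    ((measurable_swapRingDeficit z).const_mul b |>.neg.exp) (fun h p => by rw [swapRingDeficit_seamGaugeAct])
    (fun p => (Real.exp_pos _).le) (C := 1) fun p => ?_
  exact Real.exp_le_one_iff.mpr (by have := swapRingDeficit_nonneg (L := L) z p; nlinarith)

end Summit.QuantumFields.YangMills.Theorems.SwapVirialDeficit.SwapRing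

end
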